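import Mathlib.Data.Fin.Rev
import Mathlib.Order.Fin.Basic
import Mathlib.Order.Hom.Set
import Mathlib.Order.Interval.Finset.Fin
import Mathlib.Algebra.BigOperators.Intervals
import Mathlib.GroupTheory.Perm.Basic
import Mathlib.Logic.Equiv.Basic
import Literature.Computability.AlgebraicComplexity.GroupAlgebraTensor
import HarnessLib

/-!
# The inversion number on `S_n` and the structure tensor of the nil-Coxeter algebra `NC_n`

Topic `Literature/Computability/AlgebraicComplexity`. Definition item `defn-nilCoxeterTensor`
(wanted by route `MatrixMultiplication/NilCoxeterShadow`, items `stmt-MatrixMultiplication-0956 …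
0962`, which inline both notions verbatim over `Equiv.Perm (Fin n)`).

## Content

* `inversionNumber w` — the number of inversions `#{(i, j) : i < j, w j < w i}` of a permutation
  `w ∈ S_n = Equiv.Perm (Fin n)` (Björner–Brenti 2005, (1.25)); by Björner–Brenti 2005,
  Prop. 1.5.2 (= Humphreys 1990, §1.6, Exercise 2) it is the Coxeter length `ℓ_A(w)` of `w` with
  respect to the adjacent transpositions `sᵢ = (i, i+1)`. API (all proved):
  `inversionNumber_one` (`inv e = 0`), `inversionNumber_eq_zero_iff` (`inv w = 0 ↔ w = e`),
  `inversionNumber_swap_castSucc_succ` (`inv sᵢ = 1`), `inversionNumber_inv` (`inv w⁻¹ = inv w`),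
  `inversionNumber_mul_le` (subadditivity `inv (xy) ≤ inv x + inv y`), `inversionNumber_le`
  (`inv w ≤ n(n-1)/2`) and `inversionNumber_revPerm` (the maximum `n(n-1)/2` is attained at the
  order-reversing permutation `w₀ = Fin.revPerm`).
* `nilCoxeterTensor K n` — the structure tensor `T_{NC_n} ∈ K^{S_n × S_n × S_n}` of the
  **nil-Coxeter algebra** `NC_n` in its standard basis `(T_w)_{w ∈ S_n}`: index order
  `(z, x, y) = (output, left factor, right factor)` as for `structureTensor` / `groupTensor`
  (`GroupAlgebraTensor.lean`), entry `1` iff `x y = z` and `inv z = inv x + inv y`, else `0`.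
  `NC_n` is Humphreys' generic algebra `𝓔_K(a_s, b_s)` of the Coxeter system `(S_n, {sᵢ})` at the
  parameters `a_s = b_s = 0` (Humphreys 1990, §7.1, Theorem and relations (1)–(3): free module on
  `(T_w)`, `T_s T_w = T_{sw}` if `ℓ(sw) > ℓ(w)` and `T_s T_w = a_s T_w + b_s T_{sw} = 0` if
  `ℓ(sw) < ℓ(w)`), named the *NilCoxeter algebra* of `S_n` in Björner–Brenti 2005, Ch. 7,
  Exercise 20 (generators `Tᵢ`, relations `Tᵢ² = 0`, `TᵢTⱼ = TⱼTᵢ` for `|i-j| > 1`,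
  `TᵢTᵢ₊₁Tᵢ = Tᵢ₊₁TᵢTᵢ₊₁`) after Fomin–Stanley 1994, §2, whose multiplication table in the basis
  `(T_w)` is `T_x T_y = T_{xy}` if `ℓ(xy) = ℓ(x) + ℓ(y)` and `T_x T_y = 0` otherwise — equivalently,
  `NC_n = gr K[S_n]` for the length filtration `F_k = span{w : ℓ(w) ≤ k}` of the group algebra
  (an algebra filtration by `inversionNumber_mul_le`). `nilCoxeterTensor_eq` is the `rfl` bridge to
  the inlined form of the route file; `nilCoxeterTensor_one_left/right` (`T_e` is the unit).
* **Degeneration transfer** (proved): `IsApproxDecomposition.nilCoxeterTensor_of_groupTensor` — from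
  any exact decomposition `T_{K[S_n]} = ∑_ρ w_ρ ⊗ u_ρ ⊗ v_ρ` of the group tensor, the Rees twist
  `w_ρ(z) ↦ ε^{h - inv z} w_ρ(z)`, `u_ρ(x) ↦ ε^{inv x} u_ρ(x)`, `v_ρ(y) ↦ ε^{inv y} v_ρ(y)`
  (`h = n(n-1)/2`) is an order-`h` approximate decomposition of `T_{NC_n}` over `K[ε]`
  (Bläser 2013, Def. 6.1), because `∑_ρ = ε^{h + inv x + inv y - inv z}·[xy = z]` and
  `inv z ≤ inv x + inv y` with equality exactly on the support of `T_{NC_n}`; hence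
  `approxRank_nilCoxeterTensor_le : R_h(T_{NC_n}) ≤ R(T_{K[S_n]})` and
  `algBorderRank_nilCoxeterTensor_le : bR(T_{NC_n}) ≤ R(T_{K[S_n]})`. This is the tensor shadow
  of the algebraic degeneration `gr K[S_n] ⊴ₐ K[S_n]` along the one-parameter family of basis
  changes `T_w ↦ ε^{ℓ(w)} T_w` (Bläser–Lysikov 2016, §2.3 and Lemma 4: such a family exhibits an
  algebraic degeneration, which is a tensor degeneration; §2.2: `bR(φ) ≤ r ⇔ φ ⊴ k^r`).

## References

* A. Björner, F. Brenti, *Combinatorics of Coxeter Groups*, GTM 231, Springer 2005 (held: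
  `book:bjorner2005-combinatorics-coxeter-groups`): §1.5, (1.25)–(1.26) and Prop. 1.5.2
  (`ℓ_A = inv` on `S_n`); Ch. 7, Exercise 20 (the NilCoxeter algebra `𝓝_n = 𝓗_0(S_n, S)` with
  `a_s = b_s = 0`). [BjornerBrenti2005]
* J. E. Humphreys, *Reflection Groups and Coxeter Groups*, CUP 1990 (held:
  `book:humphreys1990-reflection-groups-coxeter-groups`): §1.6, Exercise 1(b) (`n(ww') ≤ n(w) + n(w')`)
  and Exercise 2 (length in `S_n` = number of inversions); §7.1, Theorem (generic algebras
  `𝓔_A(a_s, b_s)`, relations (1)–(4)). [Humphreys1990]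
* S. Fomin, R. P. Stanley, *Schubert polynomials and the nilCoxeter algebra*, Adv. Math. 103
  (1994) 196–207, §2 (paywalled, acquisition request acq-02074; section-level locator as
  transmitted by the requesting route). [FominStanley1994]
* M. Bläser, V. Lysikov, *On degeneration of tensors and algebras*, MFCS 2016, arXiv:1606.04253,
  §2.2–2.3, Lemma 4. [BlaserLysikov2016]
* M. Bläser, *Fast Matrix Multiplication*, Theory of Computing Graduate Surveys 5 (2013),
  Def. 6.1. [Blaser2013]
-/

noncomputable section

open scoped BigOperators Polynomial

namespace Literature.Computability.AlgebraicComplexity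

universe u

/-! ## The inversion number (Coxeter length) on `S_n` -/

section Inversions

variable {n : ℕ}

/-- The **inversion number** `inv(w) = #{(i, j) : i < j, w(j) < w(i)}` of a permutation
`w ∈ S_n = Equiv.Perm (Fin n)` (Björner–Brenti 2005, (1.25)); it equals the Coxeter length of `w`
with respect to the adjacent transpositions `(i, i+1)` (Björner–Brenti 2005, Prop. 1.5.2;
Humphreys 1990, §1.6, Exercise 2). [cite: BjornerBrenti2005, §1.5, (1.25) and Prop. 1.5.2] -/
def inversionNumber (w : Equiv.Perm (Fin n)) : ℕ :=
  (Finset.univ.filter (fun p : Fin n × Fin n => p.1 < p.2 ∧ w p.2 < w p.1)).card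

/-- Unfolding `inversionNumber`. [folklore] -/
theorem inversionNumber_def (w : Equiv.Perm (Fin n)) : inversionNumber w =
    (Finset.univ.filter (fun p : Fin n × Fin n => p.1 < p.2 ∧ w p.2 < w p.1)).card := rfl

/-- Membership in the inversion set. [folklore] -/
theorem mem_filter_inversion_iff (w : Equiv.Perm (Fin n)) (p : Fin n × Fin n) :
    p ∈ Finset.univ.filter (fun p : Fin n × Fin n => p.1 < p.2 ∧ w p.2 < w p.1) ↔
      p.1 < p.2 ∧ w p.2 < w p.1 := by
  simp only [Finset.mem_filter, Finset.mem_univ, true_and]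

/-- `inv(e) = 0` (Björner–Brenti 2005, proof of Prop. 1.5.2). [cite: BjornerBrenti2005, Prop. 1.5.2] -/
@[simp] theorem inversionNumber_one : inversionNumber (1 : Equiv.Perm (Fin n)) = 0 := by
  rw [inversionNumber, Finset.card_eq_zero, Finset.filter_eq_empty_iff]
  rintro p - ⟨h1, h2⟩
  rw [Equiv.Perm.one_apply, Equiv.Perm.one_apply] at h2
  exact lt_asymm h1 h2

/-- `inv(id) = 0`. [folklore] -/
@[simp] theorem inversionNumber_refl : inversionNumber (Equiv.refl (Fin n)) = 0 :=
  inversionNumber_one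

/-- **`inv(w) = 0` iff `w = e`**: a permutation without inversions is increasing, hence the
identity (Björner–Brenti 2005, proof of Prop. 1.5.2: "`inv(x) = 0`, then `x = 12…n = e`").
[cite: BjornerBrenti2005, Prop. 1.5.2 (proof)] -/
theorem inversionNumber_eq_zero_iff {w : Equiv.Perm (Fin n)} : inversionNumber w = 0 ↔ w = 1 := by
  refine ⟨fun h => ?_, fun h => h ▸ inversionNumber_one⟩
  rw [inversionNumber, Finset.card_eq_zero, Finset.filter_eq_empty_iff] at h
  have hmono : StrictMono w := by
    intro i j hij
    rcases lt_trichotomy (w i) (w j) with hlt | heq | hgt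
    · exact hlt
    · exact absurd (w.injective heq) (ne_of_lt hij)
    · exact absurd ⟨hij, hgt⟩ (h (Finset.mem_univ (i, j)))
  ext i
  have := Fin.coe_orderIso_apply (hmono.orderIsoOfSurjective w w.surjective) i
  rwa [StrictMono.coe_orderIsoOfSurjective] at this

/-- **`inv(w⁻¹) = inv(w)`**: `(i, j) ↦ (w⁻¹ j, w⁻¹ i)` is a bijection from the inversions of `w⁻¹`
onto those of `w` (Humphreys 1990, §1.6: `ℓ(w⁻¹) = ℓ(w)`). [cite: Humphreys1990, §1.6] -/
theorem inversionNumber_inv (w : Equiv.Perm (Fin n)) : inversionNumber w⁻¹ = inversionNumber w := by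
  unfold inversionNumber
  refine Finset.card_nbij' (fun p => (w⁻¹ p.2, w⁻¹ p.1)) (fun p => (w p.2, w p.1)) ?_ ?_ ?_ ?_
  · rintro ⟨a, b⟩ hp
    rw [Finset.mem_coe, mem_filter_inversion_iff] at hp ⊢
    exact ⟨hp.2, by simpa using hp.1⟩
  · rintro ⟨i, j⟩ hp
    rw [Finset.mem_coe, mem_filter_inversion_iff] at hp ⊢
    exact ⟨hp.2, by simpa using hp.1⟩
  · rintro ⟨a, b⟩ -
    simp
  · rintro ⟨i, j⟩ -
    simp

/-- **Subadditivity `inv(xy) ≤ inv(x) + inv(y)`**: an inversion `(i, j)` of `xy` is either an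
inversion of `y`, or `(y i, y j)` is an inversion of `x` (Humphreys 1990, §1.6, Exercise 1(b):
`n(ww') ≤ n(w) + n(w')`). This makes `F_k = span{w : inv(w) ≤ k}` an algebra filtration of `K[S_n]`.
[cite: Humphreys1990, §1.6, Exercise 1(b)] -/
theorem inversionNumber_mul_le (x y : Equiv.Perm (Fin n)) :
    inversionNumber (x * y) ≤ inversionNumber x + inversionNumber y := by
  unfold inversionNumber
  set Ix := Finset.univ.filter (fun p : Fin n × Fin n => p.1 < p.2 ∧ x p.2 < x p.1) with hIx
  set Iy := Finset.univ.filter (fun p : Fin n × Fin n => p.1 < p.2 ∧ y p.2 < y p.1) with hIy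
  have hsub : Finset.univ.filter (fun p : Fin n × Fin n => p.1 < p.2 ∧ (x * y) p.2 < (x * y) p.1) ⊆
      Iy ∪ Ix.image (fun q => (y⁻¹ q.1, y⁻¹ q.2)) := by
    intro p hp
    rw [mem_filter_inversion_iff, Equiv.Perm.mul_apply, Equiv.Perm.mul_apply] at hp
    rw [Finset.mem_union]
    by_cases hy : y p.2 < y p.1
    · exact Or.inl ((mem_filter_inversion_iff y p).2 ⟨hp.1, hy⟩)
    · refine Or.inr (Finset.mem_image.2 ⟨(y p.1, y p.2), ?_, by simp⟩)
      rw [hIx, mem_filter_inversion_iff]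
      refine ⟨lt_of_le_of_ne (not_lt.1 hy) (fun h => ?_), hp.2⟩
      exact absurd (y.injective h) (ne_of_lt hp.1)
  calc _ ≤ (Iy ∪ Ix.image (fun q => (y⁻¹ q.1, y⁻¹ q.2))).card := Finset.card_le_card hsub
    _ ≤ Iy.card + (Ix.image (fun q => (y⁻¹ q.1, y⁻¹ q.2))).card := Finset.card_union_le _ _
    _ ≤ Iy.card + Ix.card := Nat.add_le_add_left Finset.card_image_le _
    _ = Ix.card + Iy.card := Nat.add_comm _ _

/-- **`inv(sᵢ) = 1`** for the adjacent transposition `sᵢ = (i, i+1)`: its only inversion is the pair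
`(i, i+1)` itself (Björner–Brenti 2005, (1.26) at `x = e`). [cite: BjornerBrenti2005, §1.5, (1.26)] -/
theorem inversionNumber_swap_castSucc_succ (i : Fin n) :
    inversionNumber (Equiv.swap i.castSucc i.succ) = 1 := by
  rw [inversionNumber, Finset.card_eq_one]
  refine ⟨(i.castSucc, i.succ), ?_⟩
  ext ⟨a, b⟩
  rw [mem_filter_inversion_iff, Finset.mem_singleton, Prod.mk.injEq]
  constructor
  · rintro ⟨hab, hs⟩
    rw [Equiv.swap_apply_def, Equiv.swap_apply_def] at hs
    split_ifs at hs <;>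
      simp only [Fin.ext_iff, Fin.lt_def, Fin.val_castSucc, Fin.val_succ] at * <;> omega
  · rintro ⟨rfl, rfl⟩
    refine ⟨Fin.castSucc_lt_succ, ?_⟩
    rw [Equiv.swap_apply_right, Equiv.swap_apply_left]
    exact Fin.castSucc_lt_succ

/-- The number of pairs `i < j` in `Fin n` is `n(n-1)/2` (sum the sizes `n-1-i` of the rows).
[folklore] -/
theorem card_filter_fst_lt_snd (n : ℕ) :
    (Finset.univ.filter (fun p : Fin n × Fin n => p.1 < p.2)).card = n * (n - 1) / 2 := by
  rw [Finset.card_filter, ← Finset.univ_product_univ, Finset.sum_product]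
  have hrow : ∀ i : Fin n, (∑ j : Fin n, if i < j then 1 else 0) = n - 1 - (i : ℕ) := by
    intro i
    rw [← Finset.card_filter, Finset.filter_lt_eq_Ioi, Fin.card_Ioi]
  simp_rw [hrow]
  rw [Fin.sum_univ_eq_sum_range (fun i => n - 1 - i) n, Finset.sum_range_reflect (fun i => i) n,
    Finset.sum_range_id]

/-- **`inv(w) ≤ n(n-1)/2`**: the inversions form a subset of all pairs `i < j`.
[cite: BjornerBrenti2005, §1.5, (1.25)] -/
theorem inversionNumber_le (w : Equiv.Perm (Fin n)) : inversionNumber w ≤ n * (n - 1) / 2 := by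
  rw [inversionNumber, ← card_filter_fst_lt_snd n]
  refine Finset.card_le_card fun p hp => ?_
  rw [Finset.mem_filter] at hp ⊢
  exact ⟨hp.1, hp.2.1⟩

/-- **The maximum `n(n-1)/2` is attained at the order-reversing permutation** `w₀ = Fin.revPerm`
(`i ↦ n-1-i`, the longest element of `S_n`): every pair `i < j` is an inversion.
[cite: BjornerBrenti2005, §1.5, (1.25)] -/
theorem inversionNumber_revPerm : inversionNumber (Fin.revPerm : Equiv.Perm (Fin n)) = n * (n - 1) / 2 := by
  rw [inversionNumber, ← card_filter_fst_lt_snd n]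
  congr 1
  refine Finset.filter_congr fun p _ => ?_
  rw [Fin.revPerm_apply, Fin.revPerm_apply, Fin.rev_lt_rev]
  exact and_self_iff

end Inversions

/-! ## The structure tensor of the nil-Coxeter algebra -/

section NilCoxeter

variable (K : Type u) [CommSemiring K]

/-- The **structure tensor `T_{NC_n}` of the nil-Coxeter algebra** `NC_n` of `S_n` in its standard
basis `(T_w)_{w ∈ S_n}`, index order `(z, x, y)` = (output coordinate, left factor, right factor)
as for `structureTensor`/`groupTensor`: the coefficient of `T_z` in `T_x T_y`, i.e. `1` if
`x y = z` and `inv(z) = inv(x) + inv(y)`, and `0` otherwise — the multiplication table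
`T_x T_y = T_{xy}` if `ℓ(xy) = ℓ(x) + ℓ(y)`, `T_x T_y = 0` otherwise, of Humphreys' generic algebra
`𝓔_K(0, 0)` of `(S_n, {(i,i+1)})` (Humphreys 1990, §7.1, Theorem, (1)–(2) with `a_s = b_s = 0`),
the *NilCoxeter algebra* of Björner–Brenti 2005, Ch. 7, Exercise 20 and Fomin–Stanley 1994, §2;
equivalently the structure tensor of `gr K[S_n]` for the length filtration.
[cite: Humphreys1990, §7.1, Theorem] [cite: BjornerBrenti2005, Ch. 7, Exercise 20]
[cite: FominStanley1994, §2] -/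
def nilCoxeterTensor (n : ℕ) :
    Equiv.Perm (Fin n) → Equiv.Perm (Fin n) → Equiv.Perm (Fin n) → K :=
  fun z x y => if x * y = z ∧ inversionNumber z = inversionNumber x + inversionNumber y then 1 else 0

variable {K}

/-- Entries of the nil-Coxeter tensor. [folklore] -/
@[simp] theorem nilCoxeterTensor_apply {n : ℕ} (z x y : Equiv.Perm (Fin n)) :
    nilCoxeterTensor K n z x y =
      if x * y = z ∧ inversionNumber z = inversionNumber x + inversionNumber y then 1 else 0 := rfl

variable (K) in
/-- **Bridge to the inlined form** used by route `MatrixMultiplication/NilCoxeterShadow` (items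
`stmt-MatrixMultiplication-0956 … 0962`), which spell out `inversionNumber` as a `Finset.card`:
definitional (`rfl`). [folklore] -/
theorem nilCoxeterTensor_eq (n : ℕ) : nilCoxeterTensor K n = fun z x y : Equiv.Perm (Fin n) =>
    if x * y = z ∧ (Finset.univ.filter (fun p : Fin n × Fin n => p.1 < p.2 ∧ z p.2 < z p.1)).card =
      (Finset.univ.filter (fun p : Fin n × Fin n => p.1 < p.2 ∧ x p.2 < x p.1)).card +
      (Finset.univ.filter (fun p : Fin n × Fin n => p.1 < p.2 ∧ y p.2 < y p.1)).card
    then (1 : K) else 0 := rfl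

/-- Off the multiplication table of `S_n` the tensor vanishes: `T_{NC_n}` is supported inside the
support of the group tensor `T_{K[S_n]}`. [folklore] -/
theorem nilCoxeterTensor_apply_of_ne {n : ℕ} {z x y : Equiv.Perm (Fin n)} (h : x * y ≠ z) :
    nilCoxeterTensor K n z x y = 0 := by
  rw [nilCoxeterTensor_apply, if_neg fun h' => h h'.1]

/-- On the multiplication table: `T_x T_y = T_{xy}` if the lengths add, `= 0` otherwise
(Humphreys 1990, §7.1, (1)–(2) at `a_s = b_s = 0`). [cite: Humphreys1990, §7.1, Theorem] -/
theorem nilCoxeterTensor_apply_mul {n : ℕ} (x y : Equiv.Perm (Fin n)) :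
    nilCoxeterTensor K n (x * y) x y =
      if inversionNumber (x * y) = inversionNumber x + inversionNumber y then 1 else 0 := by
  rw [nilCoxeterTensor_apply]
  exact if_congr (by simp) rfl rfl

/-- `T_e` is a left unit: `T_e T_y = T_y` (Humphreys 1990, §7.1, Theorem: "`T_1` acting as the
identity"). [cite: Humphreys1990, §7.1, Theorem] -/
theorem nilCoxeterTensor_one_left {n : ℕ} (z y : Equiv.Perm (Fin n)) :
    nilCoxeterTensor K n z 1 y = if y = z then 1 else 0 := by
  rw [nilCoxeterTensor_apply]
  refine if_congr ⟨fun h => ?_, fun h => ?_⟩ rfl rfl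
  · simpa using h.1
  · subst h
    simp

/-- `T_e` is a right unit: `T_x T_e = T_x`. [cite: Humphreys1990, §7.1, Theorem] -/
theorem nilCoxeterTensor_one_right {n : ℕ} (z x : Equiv.Perm (Fin n)) :
    nilCoxeterTensor K n z x 1 = if x = z then 1 else 0 := by
  rw [nilCoxeterTensor_apply]
  refine if_congr ⟨fun h => ?_, fun h => ?_⟩ rfl rfl
  · simpa using h.1
  · subst h
    simp

/-- The nil-Coxeter tensor is the group tensor cut down to the length-additive part of the
multiplication table: `T_{NC_n}(z,x,y) = T_{K[S_n]}(z,x,y) · [inv z = inv x + inv y]`. [folklore] -/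
theorem nilCoxeterTensor_eq_groupTensor_mul {n : ℕ} (z x y : Equiv.Perm (Fin n)) :
    nilCoxeterTensor K n z x y = groupTensor K (Equiv.Perm (Fin n)) z x y *
      (if inversionNumber z = inversionNumber x + inversionNumber y then 1 else 0) := by
  rw [nilCoxeterTensor_apply, groupTensor_apply]
  by_cases h1 : x * y = z <;> by_cases h2 : inversionNumber z = inversionNumber x + inversionNumber y <;>
    simp [h1, h2]

/-! ### Degeneration transfer: `bR(T_{NC_n}) ≤ R(T_{K[S_n]})` -/

/-- **The Rees twist of an exact decomposition of `T_{K[S_n]}` is an order-`h` approximate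
decomposition of `T_{NC_n}`**, `h = n(n-1)/2`: if `T_{K[S_n]} = ∑_ρ w_ρ ⊗ u_ρ ⊗ v_ρ` (first factor
on the output index `z`), then with `W_ρ(z) = w_ρ(z) ε^{h - inv z}`, `U_ρ(x) = u_ρ(x) ε^{inv x}`,
`V_ρ(y) = v_ρ(y) ε^{inv y}` one has `∑_ρ W_ρ(z)U_ρ(x)V_ρ(y) = [xy = z]·ε^{h - inv z + inv x + inv y}
= ε^h T_{NC_n}(z,x,y) + O(ε^{h+1})`, since `inv(xy) ≤ inv x + inv y` (`inversionNumber_mul_le`) with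
equality exactly on the support of `T_{NC_n}`, and `inv z ≤ h` (`inversionNumber_le`). This is the
basis-change family `T_w ↦ ε^{ℓ(w)} T_w` exhibiting `NC_n = gr K[S_n]` as an algebraic degeneration
of `K[S_n]` (Bläser–Lysikov 2016, §2.3, Lemma 4), read in coordinates (Bläser 2013, Def. 6.1).
[cite: BlaserLysikov2016, §2.3, Lemma 4] [cite: Blaser2013, Def. 6.1] -/
theorem IsApproxDecomposition.nilCoxeterTensor_of_groupTensor {n r : ℕ}
    {w u v : Fin r → Equiv.Perm (Fin n) → K}
    (hdec : groupTensor K (Equiv.Perm (Fin n)) = ∑ ρ, triad (w ρ) (u ρ) (v ρ)) :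
    IsApproxDecomposition (n * (n - 1) / 2) (nilCoxeterTensor K n)
      (fun ρ z => Polynomial.C (w ρ z) * Polynomial.X ^ (n * (n - 1) / 2 - inversionNumber z))
      (fun ρ x => Polynomial.C (u ρ x) * Polynomial.X ^ inversionNumber x)
      (fun ρ y => Polynomial.C (v ρ y) * Polynomial.X ^ inversionNumber y) := by
  intro z x y j hj
  set h := n * (n - 1) / 2 with hh
  -- the entry `(z, x, y)` of the exact decomposition
  have hentry : (∑ ρ, w ρ z * u ρ x * v ρ y) = if x * y = z then (1 : K) else 0 := by
    have := congrFun (congrFun (congrFun hdec z) x) y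
    rw [groupTensor_apply] at this
    rw [this, Finset.sum_apply, Finset.sum_apply, Finset.sum_apply]
    simp only [triad_apply]
  -- the twisted sum is a single monomial
  have hmono : (∑ ρ, Polynomial.C (w ρ z) * Polynomial.X ^ (h - inversionNumber z) *
      (Polynomial.C (u ρ x) * Polynomial.X ^ inversionNumber x) *
      (Polynomial.C (v ρ y) * Polynomial.X ^ inversionNumber y)) =
      Polynomial.C (if x * y = z then (1 : K) else 0) *
        Polynomial.X ^ (h - inversionNumber z + inversionNumber x + inversionNumber y) := by
    rw [← hentry, map_sum, Finset.sum_mul]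
    refine Finset.sum_congr rfl fun ρ _ => ?_
    rw [map_mul, map_mul, pow_add, pow_add]
    ring
  rw [hmono, Polynomial.coeff_C_mul_X_pow, nilCoxeterTensor_apply]
  have hz : inversionNumber z ≤ h := inversionNumber_le z
  by_cases hxy : x * y = z
  · have hsub : inversionNumber z ≤ inversionNumber x + inversionNumber y :=
      hxy ▸ inversionNumber_mul_le x y
    simp only [hxy, true_and]
    by_cases hlen : inversionNumber z = inversionNumber x + inversionNumber y
    · rw [if_pos hlen]
      exact if_congr (by omega) rfl rfl
    · rw [if_neg hlen, if_neg (by omega)]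
      split_ifs <;> rfl
  · simp only [hxy, false_and, if_false]
    split_ifs <;> rfl

variable (K) in
/-- **`R_h(T_{NC_n}) ≤ R(T_{K[S_n]})`** for `h = n(n-1)/2` (apply the Rees twist to an optimal
exact decomposition of the group tensor). [cite: BlaserLysikov2016, §2.3, Lemma 4] -/
theorem approxRank_nilCoxeterTensor_le (n : ℕ) :
    approxRank (n * (n - 1) / 2) (nilCoxeterTensor K n) ≤
      tensorRank (groupTensor K (Equiv.Perm (Fin n))) := by
  obtain ⟨w, u, v, hdec⟩ := exists_triad_decomposition_tensorRank (groupTensor K (Equiv.Perm (Fin n)))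
  exact approxRank_le_of_isApproxDecomposition
    (IsApproxDecomposition.nilCoxeterTensor_of_groupTensor hdec)

variable (K) in
/-- **Degeneration transfer `bR(T_{NC_n}) ≤ R(T_{K[S_n]})`**: the border rank (over `K[ε]`,
Bläser 2013, Def. 6.1) of the structure tensor of the nil-Coxeter algebra is at most the rank of
the structure tensor of the group algebra of `S_n`, `NC_n = gr K[S_n]` being a degeneration of
`K[S_n]` (Bläser–Lysikov 2016, §2.2–2.3). This is item `DegenerationTransfer` of route
`MatrixMultiplication/NilCoxeterShadow`, up to `nilCoxeterTensor_eq`.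
[cite: BlaserLysikov2016, §2.3, Lemma 4] [cite: Blaser2013, Def. 6.1] -/
theorem algBorderRank_nilCoxeterTensor_le (n : ℕ) :
    algBorderRank (nilCoxeterTensor K n) ≤ tensorRank (groupTensor K (Equiv.Perm (Fin n))) :=
  (algBorderRank_le_approxRank _ _).trans (approxRank_nilCoxeterTensor_le K n)

end NilCoxeter

end Literature.Computability.AlgebraicComplexity

end
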